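import Summits.CriticalPhenomena.PercolationContinuityZ3.Theorems.PercNearOneGluingNoHeavyRsw3AnnulusTwoArmSeparation
import Summits.CriticalPhenomena.PercolationContinuityZ3.Theorems.PercAnnulusCrossingSpanningCountBK
import Summits.CriticalPhenomena.PercolationContinuityZ3.Theorems.PercNearOneGluingNoHeavyRsw3AnnulusBKCovering
import HarnessLib

/-!
# RSW3 lane (P2, gen 9): `X_B ⇒ AnnulusTwoArmLowerBound` — the 3-D RSW UPPER bound at aspect 2 implies the aspect-2
# annulus TWO-ARM lower bound; and the unconditional BLOCKING-OR-TWO-ARMS dichotomy at `p_c(ℤ³)`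

builds on p205010 (kernel theorem, internal audit signed; external expert review pending)

Cell `prim-rsw3`, prover seat `prim-rsw3-p2` (gen 9), memo `run/shared/lean/prim/rsw3/P2-RSWLITE.md` §15.
Support file (`--supports stmt-CriticalPhenomena-4575`); no definitions, no named facts, no sorries.  Part II of two
(part I: `…Rsw3AnnulusTwoArmSeparation`, the every-`p` inequality `σ₂(n)² · P_p(W) ≤ α₂(n, 2n)`).

Notation as in part I: `α₂(m,N) = Crossing.annulusTwoArmProb 3 p m N`, `σ₂(n) = P_p(boxCross (easyShape 2 n) 0)`,
`u_p(r, R) = P_p(SurfaceTension.boxCrossing 3 r R) = P_p(Λ(r) ↔ ∂ⁱⁿΛ(R) in Λ(R))`.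

RESULTS.
* `sq_mul_one_sub_pow_le_annulusTwoArmProb` — every `p`, every `n ≥ 1`: `σ₂(n)² (1-p)^{(4n+1)⁶} ≤ α₂(n, 2n)` (middle layer
  = every pair at the plane `{x₀ = 0}` closed; positivity with a useless rate, used for the scales `n ≤ 2`).
* `sq_mul_blocking_pow_le_annulusTwoArmProb` — **BLOCKING-OR-TWO-ARMS, every `p`, `n ≥ 3`, `r = ⌊(n-1)/2⌋`:**
  `σ₂(n)² · (1 - u_p(r, 2r))^{81} ≤ α₂(n, 2n)`.  Middle layer = a wall of `81` blocked aspect-2 annuli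
  `Λ_z(r) ↮ ∂ⁱⁿΛ_z(2r)` centred on the plane `{x₀ = 0}` (lateral grid of pitch `2r+1`, `k ∈ Λ²(4)`): a path from `{x₀ = -n}`
  to `{x₀ = n}` inside `Λ(2n)` passes the plane at a site `q` of some `Λ_z(r)` (`SurfaceTension.mem_sbox_gridPt`,
  `gridIdx_mem_box` with `2n + r < 5(2r+1)`) and leaves `Λ_z(2r)` (`2r < n`), so it realises that annulus crossing (part I's
  exit lemma); the balls lie in `{|x₀| ≤ 2r}`; Harris for the `81` decreasing events and translation invariance.
* `exists_mul_blocking_pow_le_annulusTwoArmProb_criticalProbI` — at `p_c(ℤ³)`, unconditionally: `∃ c > 0, ∀ n ≥ 3,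
  c (1 - u_{p_c}(r, 2r))^{81} ≤ α₂(n, 2n)` (`c` = square of the `EasyCrossingLowerBound 2` constant): at every scale, EITHER the
  aspect-2 two-arm probability is bounded below OR the aspect-2 annulus at half the scale is crossed with probability close
  to one (the proliferation picture valid above six dimensions).  Companion of the lead's HARD-OR-TWO-ARMS dichotomy
  (`Crossing.pow_le_real_boxCross_add_mul_annulusTwoArmProb`, p217384).
* `annulusTwoArmLowerBound_of_critAnnulusNonCrossing` — **`X_B ⇒ Crossing.AnnulusTwoArmLowerBound`**
  (`X_B = PercAnnulusCrossing.CritAnnulusNonCrossing`, stmt-CriticalPhenomena-0846, gives `1 - u_{p_c}(r,2r) ≥ c_X`; small scales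
  by the positivity instance and `p_c < 1`); counting form `exists_le_real_two_le_annulusClusterCount_of_critAnnulusNonCrossing`
  (`P_{p_c}(2 ≤ annulusClusterCount 3 n (2n)) ≥ c`); and `annulusTwoArmLowerBound_and_tight_of_critAnnulusNonCrossing`:
  together with the lead's `Crossing.annulusClusterCountTight_of_critAnnulusNonCrossing` (Aizenman's (3.1) by BK), the SINGLE
  hypothesis `X_B` controls BOTH tails of the number `N(n, 2n)` of annulus-crossing clusters at `p_c(ℤ³)` — `≥ 2` with
  probability bounded below, and tight — the Borgs–Chayes–Kesten–Spencer "`Θ(1)` macroscopic clusters" picture for annuli.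

HONEST PLACEMENT.  LANE 3 LADDER: R2 (`X_B`) ⇒ R3.2 (aspect-2 two-arm lower bound), new edge of the lane's implication
diagram (the tree had R2 ⇒ R4-tightness, R1.c ∨ frequent non-uniqueness, and the thin-aspect theorem
`Rsw3.annulusTwoArmProb_criticalProbI_lower`, Aizenman 1997 Thm. 2).  Both `X_B` and `AnnulusTwoArmLowerBound` remain OPEN;
`X_B` is false above six dimensions while `AnnulusTwoArmLowerBound` is expected in every dimension, so the converse is not
to be expected.  Numerically (lane census, non-rigorous) `α₂(n, 2n) ≈ 1` and `u(n, 2n) ≈ 0.998` at `p_c(ℤ³)`.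

References: M. Aizenman, Nucl. Phys. B 485 (1997) 551–582, §2 Thm. 2, Remark 2, §3 (3.1) [Aizenman1997]; C. Borgs, J. Chayes,
H. Kesten, J. Spencer, Random Structures Algorithms 15 (1999) 368–413, §1 [BorgsChayesKestenSpencer1999]; G. Grimmett,
*Percolation* (1999), §1.3, §2.2 [GrimmettPercolation1999]; S. Martineau, V. Tassion, Ann. Probab. 45 (2017) §3.1.2
[MartineauTassion2017]. [folklore]
-/

noncomputable section

namespace Summit.CriticalPhenomena.PercolationContinuityZ3.Theorems

open MeasureTheory ProbabilityTheory Filter Topology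
open Literature.Probability.Percolation Literature.Probability.LatticeModels
open Literature.Barriers.CriticalPhenomena

namespace Rsw3

open SurfaceTension Crossing

variable {d : ℕ}


/-! ## Instance 1 (every `n ≥ 1`, positivity): all edges at the plane `{x₀ = 0}` closed -/

/-- **`σ₂(n)² · (1-p)^{(4n+1)⁶} ≤ α₂(n, 2n)` for every `p` and every `n ≥ 1`.**  Take `W` = "every pair
`s(q, q')` with `q ∈ Λ(2n) ∩ {x₀ = 0}`, `q' ∈ Λ(2n)` is closed" (at most `|Λ(2n)|² = (4n+1)⁶` pairs, each closed with
probability `≥ 1 - p`): a path from `{x₀ = -n}` to `{x₀ = n}` inside `Λ(2n)` visits the plane `{x₀ = 0}` and its next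
step is such a pair.  A positivity statement (useless rate), used below for the small scales. [folklore] -/
theorem sq_mul_one_sub_pow_le_annulusTwoArmProb (p : unitInterval) {n : ℕ} (hn : 1 ≤ n) :
    (bondPercolation (zdGraph 3) p).real (boxCross (easyShape 2 n) 0) ^ 2 *
        (1 - (p : ℝ)) ^ ((4 * n + 1) ^ 6) ≤
      annulusTwoArmProb 3 p n (2 * n) := by
  classical
  set μ := bondPercolation (zdGraph 3) p with hμ
  set P0 : Finset (Site 3) := (box 3 (2 * n)).filter (fun x => x 0 = 0) with hP0
  set F : Finset (Sym2 (Site 3)) := ((P0 ×ˢ box 3 (2 * n)).image fun q => s(q.1, q.2)) with hF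
  set W : Set (BondConfig (Site 3)) := {ω | ∀ e ∈ F, e ∉ ω} with hW
  -- `W` qualifies
  have hWT : DeterminedBy W (↑F : Set (Sym2 (Site 3))) := determinedBy_forall_notMem F
  have hWm : MeasurableSet W := measurableSet_forall_notMem F
  have hT : ∀ e ∈ (↑F : Set (Sym2 (Site 3))), ∃ x ∈ e, |x 0| < (n : ℤ) := by
    intro e he
    rw [Finset.mem_coe, hF, Finset.mem_image] at he
    obtain ⟨q, hq, rfl⟩ := he
    rw [Finset.mem_product, hP0, Finset.mem_filter] at hq
    refine ⟨q.1, Sym2.mem_mk_left _ _, ?_⟩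
    rw [hq.1.2]; simp; exact_mod_cast hn
  have hkill : ∀ ω, ω ⊆ (zdGraph 3).edgeSet → ω ∈ W → ∀ a b : Site 3, a 0 = -(n : ℤ) → b 0 = n →
      ¬ (openGraph ω ⊓ withinGraph (zdGraph 3) (↑(box 3 (2 * n)) : Set (Site 3))).Reachable a b := by
    intro ω _ hWω a b ha hb hab
    obtain ⟨q, hq0, -, hqb⟩ := exists_plane_of_reachable ha hb hab
    have hqb_ne : q ≠ b := by
      intro h; rw [h, hb] at hq0
      have : (1 : ℤ) ≤ n := by exact_mod_cast hn
      omega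
    obtain ⟨Wk⟩ := hqb
    cases Wk with
    | nil => exact hqb_ne rfl
    | @cons _ q' _ hadj _ =>
      obtain ⟨hopen, hwithin⟩ := (SimpleGraph.inf_adj _ _ _ _).1 hadj
      rw [withinGraph_adj] at hwithin
      have hmem : s(q, q') ∈ F := by
        rw [hF, Finset.mem_image]
        refine ⟨(q, q'), ?_, rfl⟩
        rw [Finset.mem_product, hP0, Finset.mem_filter]
        exact ⟨⟨Finset.mem_coe.1 hwithin.2.1, hq0⟩, Finset.mem_coe.1 hwithin.2.2⟩
      exact hWω _ hmem ((openGraph_adj ω q q').1 hopen).1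
  have hmain := sq_mul_real_le_annulusTwoArmProb p hn hWT hWm hT hkill
  -- `P(W) ≥ (1-p)^{|F|} ≥ (1-p)^{(4n+1)^6}`
  have hcardF : F.card ≤ (4 * n + 1) ^ 6 := by
    have h1 : F.card ≤ (P0 ×ˢ box 3 (2 * n)).card := Finset.card_image_le
    have h2 : (P0 ×ˢ box 3 (2 * n)).card = P0.card * (box 3 (2 * n)).card := Finset.card_product _ _
    have h3 : P0.card ≤ (box 3 (2 * n)).card := Finset.card_filter_le _ _
    have h4 : (box 3 (2 * n)).card = (2 * (2 * n) + 1) ^ 3 := card_box 3 (2 * n)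
    have h5 : (2 * (2 * n) + 1) ^ 3 * (2 * (2 * n) + 1) ^ 3 = (4 * n + 1) ^ 6 := by ring_nf
    calc F.card ≤ P0.card * (box 3 (2 * n)).card := by rw [← h2]; exact h1
      _ ≤ (box 3 (2 * n)).card * (box 3 (2 * n)).card := Nat.mul_le_mul_right _ h3
      _ = (4 * n + 1) ^ 6 := by rw [h4, h5]
  have hp0 : 0 ≤ 1 - (p : ℝ) := by linarith [p.2.2]
  have hp1 : 1 - (p : ℝ) ≤ 1 := by linarith [p.2.1]
  have hPW : (1 - (p : ℝ)) ^ ((4 * n + 1) ^ 6) ≤ μ.real W :=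
    (pow_le_pow_of_le_one hp0 hp1 hcardF).trans (le_bondPercolation_real_forall_notMem (zdGraph 3) p F)
  have h0 : 0 ≤ μ.real (boxCross (easyShape 2 n) 0) ^ 2 := by positivity
  exact (mul_le_mul_of_nonneg_left hPW h0).trans hmain

/-! ## Instance 2 (`n ≥ 3`): a wall of blocked aspect-2 annuli at the plane `{x₀ = 0}` -/

/-- **BLOCKING-OR-TWO-ARMS, every `p`:** for `n ≥ 3` and `r = ⌊(n-1)/2⌋`,
`σ₂(n)² · (1 - u_p(r, 2r))^{81} ≤ α₂(n, 2n)`, where `σ₂(n) = P_p(boxCross (easyShape 2 n) 0)` and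
`u_p(r,2r) = P_p(Λ(r) ↔ ∂ⁱⁿΛ(2r) in Λ(2r))` (`SurfaceTension.boxCrossing 3 r (2r)`).  The middle-layer event is
`W = ⋂_k {Λ_{z_k}(r) ↮ ∂ⁱⁿΛ_{z_k}(2r) in Λ_{z_k}(2r)}` over the `81` centres `z_k = (0, (2r+1)k₁, (2r+1)k₂)`, `k ∈ Λ²(4)`,
on the plane `{x₀ = 0}`: a path from `{x₀ = -n}` to `{x₀ = n}` inside `Λ(2n)` passes the plane at a site `q` of some
`Λ_{z_k}(r)` (grid of pitch `2r+1`; `2n + r < 5(2r+1)`) and leaves `Λ_{z_k}(2r)` (`2r < n`), so it crosses that annulus;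
the balls lie in `{|x₀| ≤ 2r}`, edge-disjoint from the two radial slabs; Harris (decreasing events) and translation
invariance give `P_p(W) ≥ (1 - u_p(r,2r))^{81}`. [folklore] -/
theorem sq_mul_blocking_pow_le_annulusTwoArmProb (p : unitInterval) {n : ℕ} (hn : 3 ≤ n) :
    (bondPercolation (zdGraph 3) p).real (boxCross (easyShape 2 n) 0) ^ 2 *
        (1 - (bondPercolation (zdGraph 3) p).real
          (boxCrossing 3 ((n - 1) / 2) (2 * ((n - 1) / 2)))) ^ 81 ≤
      annulusTwoArmProb 3 p n (2 * n) := by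
  classical
  set μ := bondPercolation (zdGraph 3) p with hμ
  set r : ℕ := (n - 1) / 2 with hr
  have hr1 : 1 ≤ r := by omega
  have h2r : 2 * r + 1 ≤ n := by omega
  have hK : ((2 * n : ℕ) : ℤ) + r < (4 + 1) * (2 * (r : ℤ) + 1) := by push_cast; omega
  -- centres, events
  set z : Site 2 → Site 3 := fun k => ![0, (2 * (r : ℤ) + 1) * k 0, (2 * (r : ℤ) + 1) * k 1] with hz
  have hz0 : ∀ k, z k 0 = 0 := fun k => by simp [hz]
  set s : Finset (Site 2) := box 2 4 with hs
  have hscard : s.card = 81 := by rw [hs, card_box]; norm_num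
  set A : Site 2 → Set (BondConfig (Site 3)) := fun k =>
    (linked (↑((box 3 (2 * r)).image (· + z k)) : Set (Site 3))
      ((zdShiftIso (z k)) '' ↑(innerBoundary (zdGraph 3) (box 3 (2 * r)))) (sbox (z k) r))ᶜ with hA
  have hsb : ∀ k, (↑((box 3 (2 * r)).image (· + z k)) : Set (Site 3)) = sbox (z k) (2 * r) := by
    intro k; rw [sbox, zdShiftIso_image_box]
  set W : Set (BondConfig (Site 3)) := ⋂ k ∈ s, A k with hW
  set T : Set (Sym2 (Site 3)) := ⋃ k ∈ s, (↑(edgesIn (zdGraph 3) ((box 3 (2 * r)).image (· + z k))) :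
    Set (Sym2 (Site 3))) with hT_def
  -- `W` qualifies
  have hdetA : ∀ k ∈ s, DeterminedBy (A k)
      (↑(edgesIn (zdGraph 3) ((box 3 (2 * r)).image (· + z k))) : Set (Sym2 (Site 3))) :=
    fun k _ => (determinedBy_linked_edgesIn _ _ _).compl'
  have hWT : DeterminedBy W T := DeterminedBy.biInter s hdetA
  have hAm : ∀ k ∈ s, MeasurableSet (A k) := fun k _ => (measurableSet_linked _ _ _).compl
  have hWm : MeasurableSet W := MeasurableSet.biInter s.countable_toSet hAm
  have hT : ∀ e ∈ T, ∃ x ∈ e, |x 0| < (n : ℤ) := by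
    intro e he
    rw [hT_def, Set.mem_iUnion₂] at he
    obtain ⟨k, -, hek⟩ := he
    rw [Finset.mem_coe, mem_edgesIn_iff] at hek
    refine ⟨e.out.1, Sym2.out_fst_mem e, ?_⟩
    have hx := hek.2 _ (Sym2.out_fst_mem e)
    rw [Finset.mem_image] at hx
    obtain ⟨y, hy, hyx⟩ := hx
    rw [← hyx, Pi.add_apply, hz0, add_zero]
    have := (mem_box.1 hy) 0
    rw [abs_lt]; constructor <;> omega
  have hkill : ∀ ω, ω ⊆ (zdGraph 3).edgeSet → ω ∈ W → ∀ a b : Site 3, a 0 = -(n : ℤ) → b 0 = n →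
      ¬ (openGraph ω ⊓ withinGraph (zdGraph 3) (↑(box 3 (2 * n)) : Set (Site 3))).Reachable a b := by
    intro ω _ hWω a b ha hb hab
    obtain ⟨q, hq0, haq, hqb⟩ := exists_plane_of_reachable ha hb hab
    have haq_ne : a ≠ q := by
      intro h; rw [← h, ha] at hq0; omega
    have hqS : q ∈ box 3 (2 * n) := Finset.mem_coe.1 (mem_of_reachable_inf_withinGraph haq haq_ne)
    -- the grid block of `q`
    set k : Site 2 := ![gridIdx r q 1, gridIdx r q 2] with hk
    have hg0 : gridIdx r q 0 = 0 := by
      simp only [gridIdx, hq0, zero_add]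
      exact Int.ediv_eq_zero_of_lt (by omega) (by omega)
    have hzk : z k = gridPt r (gridIdx r q) := by
      funext i
      fin_cases i
      · simp [hz, gridPt, hg0]
      · simp [hz, hk, gridPt]
      · simp [hz, hk, gridPt]
    have hq_in : q ∈ sbox (z k) r := by rw [hzk]; exact mem_sbox_gridPt r q
    have hk_mem : k ∈ s := by
      have hg := gridIdx_mem_box (d := 3) (L := r) (M := 2 * n) (K := 4) hK hqS
      rw [hs, mem_box]
      intro i
      fin_cases i
      · simpa [hk] using (mem_box.1 hg) 1
      · simpa [hk] using (mem_box.1 hg) 2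
    have hb_out : b ∉ sbox (z k) (2 * r) := by
      intro hb'
      have := (mem_sbox_iff.1 hb') 0
      rw [hz0, hb] at this
      push_cast at this
      omega
    have hqb' : (openGraph ω ⊓ zdGraph 3).Reachable q b :=
      hqb.mono (inf_le_inf_left _ (withinGraph_le _ _))
    have hcross := mem_annCrossAt_of_reachable (by omega : r ≤ 2 * r) hq_in hb_out hqb'
    rw [← hsb k] at hcross
    have hAk : ω ∈ A k := (Set.mem_iInter₂.1 hWω) k hk_mem
    exact hAk hcross
  have hmain := sq_mul_real_le_annulusTwoArmProb p (by omega) hWT hWm hT hkill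
  -- `P(W) ≥ ∏ P(A k) = (1 - u_p(r,2r))^{81}`
  have hlow : ∀ k ∈ s, IsLowerSet (A k) := fun k _ => (isUpperSet_linked _ _ _).compl
  have hPA : ∀ k ∈ s, μ.real (A k) = 1 - μ.real (boxCrossing 3 r (2 * r)) := by
    intro k _
    rw [hA]
    show μ.real (linked (↑((box 3 (2 * r)).image (· + z k)) : Set (Site 3))
      ((zdShiftIso (z k)) '' ↑(innerBoundary (zdGraph 3) (box 3 (2 * r)))) (sbox (z k) r))ᶜ = _
    rw [probReal_compl_eq_one_sub (measurableSet_linked _ _ _), hsb k, hμ, real_sCrossAt_eq]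
  have hPW : (1 - μ.real (boxCrossing 3 r (2 * r))) ^ 81 ≤ μ.real W := by
    have h := prod_le_real_biInter_of_isLowerSet (zdGraph 3) p s A hlow hAm
    rw [Finset.prod_congr rfl hPA, Finset.prod_const, hscard] at h
    exact h
  have h0 : 0 ≤ μ.real (boxCross (easyShape 2 n) 0) ^ 2 := by positivity
  exact (mul_le_mul_of_nonneg_left hPW h0).trans hmain

/-! ## At `p_c(ℤ³)`: `X_B ⇒ AnnulusTwoArmLowerBound`, and the unconditional BLOCKING-OR-TWO-ARMS dichotomy -/

/-- **BLOCKING-OR-TWO-ARMS at `p_c(ℤ³)`, unconditional:** there is `c > 0` (the square of the `EasyCrossingLowerBound 2`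
constant) with `c · (1 - u_{p_c}(r, 2r))^{81} ≤ α₂(n, 2n)` for all `n ≥ 3`, `r = ⌊(n-1)/2⌋`.  So at every scale either
the aspect-2 two-arm probability `α₂(n,2n)` is at least `c/2·…`, or the aspect-2 annulus at scale `≈ n/2` is crossed with
probability close to `1` — the proliferation picture that holds above six dimensions.
builds on p205010 (kernel theorem, internal audit signed; external expert review pending). [folklore] -/
theorem exists_mul_blocking_pow_le_annulusTwoArmProb_criticalProbI :
    ∃ c : ℝ, 0 < c ∧ ∀ n : ℕ, 3 ≤ n →
      c * (1 - (bondPercolation (zdGraph 3) (criticalProbI 3)).real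
          (boxCrossing 3 ((n - 1) / 2) (2 * ((n - 1) / 2)))) ^ 81 ≤
        annulusTwoArmProb 3 (criticalProbI 3) n (2 * n) := by
  obtain ⟨cE, hcE, hE⟩ := easyCrossingLowerBound_two
  refine ⟨cE ^ 2, by positivity, fun n hn => ?_⟩
  have h1' : (bondPercolation (zdGraph 3) (criticalProbI 3)).real
      (boxCrossing 3 ((n - 1) / 2) (2 * ((n - 1) / 2))) ≤ 1 := measureReal_le_one
  have h1 : 0 ≤ 1 - (bondPercolation (zdGraph 3) (criticalProbI 3)).real
      (boxCrossing 3 ((n - 1) / 2) (2 * ((n - 1) / 2))) := by linarith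
  have hσ : cE ^ 2 ≤ (bondPercolation (zdGraph 3) (criticalProbI 3)).real (boxCross (easyShape 2 n) 0) ^ 2 :=
    pow_le_pow_left₀ hcE.le (hE n (by omega)) 2
  exact (mul_le_mul_of_nonneg_right hσ (pow_nonneg h1 _)).trans
    (sq_mul_blocking_pow_le_annulusTwoArmProb (criticalProbI 3) hn)

/-- **`X_B ⇒ AnnulusTwoArmLowerBound`.**  If the aspect-2 annulus is blocked with probability bounded below at
`p_c(ℤ³)` (`PercAnnulusCrossing.CritAnnulusNonCrossing`, stmt-CriticalPhenomena-0846, the 3-D RSW upper bound), then the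
aspect-2 annulus TWO-ARM probability is bounded below: `∃ c > 0, ∀ n ≥ 1, c ≤ annulusTwoArmProb 3 p_c n (2n)`
(`Crossing.AnnulusTwoArmLowerBound`, lane LADDER R3.2, open unconditionally; gen 4 proved it only at thin aspect
`1 + 1/K`).  Scales `n ≥ 3`: `sq_mul_blocking_pow_le_annulusTwoArmProb` with `1 - u_{p_c}(r,2r) ≥ c_X`
(`boxCrossing_subset_annulusCrossing`); scales `n ≤ 2`: `sq_mul_one_sub_pow_le_annulusTwoArmProb` (`p_c < 1`).  The
easy-crossing input is `Rsw3.easyCrossingLowerBound_two` (proved).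
builds on p205010 (kernel theorem, internal audit signed; external expert review pending). [folklore] -/
theorem annulusTwoArmLowerBound_of_critAnnulusNonCrossing
    (hX : Summit.CriticalPhenomena.PercolationContinuityZ3.Theses.PercAnnulusCrossing.CritAnnulusNonCrossing) :
    AnnulusTwoArmLowerBound := by
  obtain ⟨cX, hcX, hX'⟩ := critAnnulusNonCrossing_iff.1 hX
  obtain ⟨cE, hcE, hE⟩ := easyCrossingLowerBound_two
  set pc : unitInterval := criticalProbI 3 with hpc
  set μ := bondPercolation (zdGraph 3) pc with hμ
  have hpc1 : (pc : ℝ) < 1 := by rw [hpc, coe_criticalProbI]; exact criticalProb_zd_lt_one (by norm_num)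
  have h1pc : 0 < 1 - (pc : ℝ) := by linarith
  -- large scales
  have hbig : ∀ n : ℕ, 3 ≤ n → cE ^ 2 * cX ^ 81 ≤ annulusTwoArmProb 3 pc n (2 * n) := by
    intro n hn
    set r : ℕ := (n - 1) / 2 with hr
    have hr1 : 1 ≤ r := by omega
    have hu : μ.real (boxCrossing 3 r (2 * r)) ≤ 1 - cX :=
      (measureReal_mono (boxCrossing_subset_annulusCrossing (d := 3) r) (measure_ne_top _ _)).trans (hX' r hr1)
    have hX0 : cX ≤ 1 - μ.real (boxCrossing 3 r (2 * r)) := by linarith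
    have hσ : cE ^ 2 ≤ μ.real (boxCross (easyShape 2 n) 0) ^ 2 := pow_le_pow_left₀ hcE.le (hE n (by omega)) 2
    calc cE ^ 2 * cX ^ 81 ≤ μ.real (boxCross (easyShape 2 n) 0) ^ 2 *
          (1 - μ.real (boxCrossing 3 r (2 * r))) ^ 81 :=
          mul_le_mul hσ (pow_le_pow_left₀ hcX.le hX0 81) (by positivity) (by positivity)
      _ ≤ _ := sq_mul_blocking_pow_le_annulusTwoArmProb pc hn
  -- small scales
  have hsmall : ∀ n : ℕ, 1 ≤ n → n ≤ 2 →
      cE ^ 2 * (1 - (pc : ℝ)) ^ ((4 * 2 + 1) ^ 6) ≤ annulusTwoArmProb 3 pc n (2 * n) := by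
    intro n hn hn2
    have hσ : cE ^ 2 ≤ μ.real (boxCross (easyShape 2 n) 0) ^ 2 := pow_le_pow_left₀ hcE.le (hE n hn) 2
    have hexp : (4 * n + 1) ^ 6 ≤ (4 * 2 + 1) ^ 6 := Nat.pow_le_pow_left (by omega) 6
    calc cE ^ 2 * (1 - (pc : ℝ)) ^ ((4 * 2 + 1) ^ 6)
        ≤ μ.real (boxCross (easyShape 2 n) 0) ^ 2 * (1 - (pc : ℝ)) ^ ((4 * n + 1) ^ 6) :=
          mul_le_mul hσ (pow_le_pow_of_le_one h1pc.le (by linarith [pc.2.1]) hexp) (by positivity)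
            (by positivity)
      _ ≤ _ := sq_mul_one_sub_pow_le_annulusTwoArmProb pc hn
  refine ⟨min (cE ^ 2 * cX ^ 81) (cE ^ 2 * (1 - (pc : ℝ)) ^ ((4 * 2 + 1) ^ 6)),
    lt_min (by positivity) (mul_pos (by positivity) (pow_pos h1pc _)), fun n hn => ?_⟩
  by_cases h3 : 3 ≤ n
  · exact (min_le_left _ _).trans (hbig n h3)
  · exact (min_le_right _ _).trans (hsmall n hn (by omega))

/-- **Counting form**: under `X_B`, with probability `≥ c` at least two distinct open clusters of the free ball `Λ(2n)`
join `Λ(n)` to `∂ⁱⁿΛ(2n)`, for every `n ≥ 1` (`Crossing.annulusClusterCount`, census Q5).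
builds on p205010 (kernel theorem, internal audit signed; external expert review pending). [folklore] -/
theorem exists_le_real_two_le_annulusClusterCount_of_critAnnulusNonCrossing
    (hX : Summit.CriticalPhenomena.PercolationContinuityZ3.Theses.PercAnnulusCrossing.CritAnnulusNonCrossing) :
    ∃ c : ℝ, 0 < c ∧ ∀ n : ℕ, 1 ≤ n →
      c ≤ (bondPercolation (zdGraph 3) (criticalProbI 3)).real
        {ω | 2 ≤ annulusClusterCount 3 n (2 * n) ω} := by
  obtain ⟨c, hc, h⟩ := annulusTwoArmLowerBound_of_critAnnulusNonCrossing hX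
  exact ⟨c, hc, fun n hn => (h n hn).trans
    (real_compl_uniqZone_le_real_two_le_annulusClusterCount 3 (criticalProbI 3) n (2 * n))⟩

/-- **`X_B` controls BOTH tails of the annulus cluster count at `p_c(ℤ³)`:** the lower tail (`≥ 2` clusters with probability
bounded below, this file) and the upper tail (tightness, `Crossing.annulusClusterCountTight_of_critAnnulusNonCrossing`,
lead file `PercAnnulusCrossingSpanningCountBK`, Aizenman's (3.1) via BK) — i.e. the Borgs–Chayes–Kesten–Spencer picture
"`Θ(1)` macroscopic clusters in the annulus" follows from the single RSW-upper-bound hypothesis `X_B`.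
builds on p205010 (kernel theorem, internal audit signed; external expert review pending).
[cite: BorgsChayesKestenSpencer1999, §1 (postulates)] -/
theorem annulusTwoArmLowerBound_and_tight_of_critAnnulusNonCrossing
    (hX : Summit.CriticalPhenomena.PercolationContinuityZ3.Theses.PercAnnulusCrossing.CritAnnulusNonCrossing) :
    AnnulusTwoArmLowerBound ∧ AnnulusClusterCountTight :=
  ⟨annulusTwoArmLowerBound_of_critAnnulusNonCrossing hX, annulusClusterCountTight_of_critAnnulusNonCrossing hX⟩

end Rsw3

end Summit.CriticalPhenomena.PercolationContinuityZ3.Theorems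

end
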